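import Literature.GroupTheory.CombinatorialGroupTheory.CyclicBlockInterchangeTracking
import Mathlib.Data.List.ReduceOption
import Mathlib.Data.List.Flatten
import HarnessLib

/-!
# Heuer's counting function `ν` for the 3-PARTITION gadget (Heuer 2020, §4.1, Lemma 4.5)

[Heuer2020, §4.1]: for a (cyclic) word `x` over `{a, b, c, d}` and letters `y, z` let `ν_{yz}(x)`
count the occurrences of `yz` as a cyclic subword, and
"`ν = ν_aa + ν_bc + ν_cd + ν_db − ν_ac − ν_cc − ν_dd − ν_da − ν_bb`".
**Lemma 4.5**: (ii) a cyclic block interchange lowers `ν` by at most `6`; (iii) if it lowers `ν` by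
exactly `6` then it "does not cut a subword of the form `cc`".

This file: `ν` of a cyclic word as the sum of a weight over cyclically adjacent pairs
(`CBI.nuC`, rotation invariant), its list form and concatenation rules (`CBI.nuL`, `CBI.lin`), the
finite verification behind Lemma 4.5 (a case analysis over the first and last letters of the
blocks, `CBI.delta4_le` / `CBI.delta3_le` and the `cc` statements, by `decide`), and Lemma 4.5
(ii)/(iii) for an interchange given by its blocks.

Everything here is proved; no named facts.

## References

* [Heuer2020] N. Heuer, *Computing commutator length is hard*, arXiv:2001.10230, §4.1, Lemma 4.5.
-/

namespace Literature.GroupTheory.CombinatorialGroupTheory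

namespace CBI

open Equiv Equiv.Perm

/-- The weight of an adjacent pair: `+1` on `aa, bc, cd, db`, `−1` on `ac, cc, dd, da, bb`, else `0`
(`a, b, c, d = 0, 1, 2, 3`). [cite: Heuer2020, §4.1] -/
def wt (x y : Fin 4) : ℤ :=
  if (x = 0 ∧ y = 0) ∨ (x = 1 ∧ y = 2) ∨ (x = 2 ∧ y = 3) ∨ (x = 3 ∧ y = 1) then 1
  else if (x = 0 ∧ y = 2) ∨ (x = 2 ∧ y = 2) ∨ (x = 3 ∧ y = 3) ∨ (x = 3 ∧ y = 0) ∨ (x = 1 ∧ y = 1) then -1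
  else 0

/-- `|wt| ≤ 1`. [folklore] -/
theorem wt_le_one (x y : Fin 4) : wt x y ≤ 1 := by unfold wt; split_ifs <;> omega

/-- `|wt| ≤ 1`. [folklore] -/
theorem neg_one_le_wt (x y : Fin 4) : -1 ≤ wt x y := by unfold wt; split_ifs <;> omega

/-- The change of `ν` under a non-degenerate interchange `w₁w₂w₃w₄ → w₁w₄w₃w₂`, as a function of
the first/last letters `fᵢ, lᵢ` of the blocks: removed junctions minus created ones. [cite: Heuer2020, Lemma 4.5] -/
def delta4 (f₁ l₁ f₂ l₂ f₃ l₃ f₄ l₄ : Fin 4) : ℤ :=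
  (wt l₁ f₂ + wt l₂ f₃ + wt l₃ f₄ + wt l₄ f₁) - (wt l₁ f₄ + wt l₄ f₃ + wt l₃ f₂ + wt l₂ f₁)

/-- The change of `ν` under an interchange with one empty block, `XYZ → XZY`. [cite: Heuer2020, Lemma 4.5] -/
def delta3 (fX lX fY lY fZ lZ : Fin 4) : ℤ :=
  (wt lX fY + wt lY fZ + wt lZ fX) - (wt lX fZ + wt lZ fY + wt lY fX)

/-- **Lemma 4.5 (ii)/(iii), three blocks** (finite verification): the drop is at most `6`, and a
drop of `6` cuts no `cc`. [cite: Heuer2020, Lemma 4.5] -/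
theorem delta3_le (fX lX fY lY fZ lZ : Fin 4) :
    delta3 fX lX fY lY fZ lZ ≤ 6 ∧ (delta3 fX lX fY lY fZ lZ = 6 →
      ¬(lX = 2 ∧ fY = 2) ∧ ¬(lY = 2 ∧ fZ = 2) ∧ ¬(lZ = 2 ∧ fX = 2)) := by
  revert fX lX fY lY fZ lZ
  decide

set_option maxHeartbeats 4000000 in
/-- Lemma 4.5 (ii)/(iii), four blocks, with the first junction fixed (the finite verification,
`4⁸` cases). [cite: Heuer2020, Lemma 4.5] -/
theorem delta4_le_aux (l₁ f₂ : Fin 4) : ∀ f₁ l₂ f₃ l₃ f₄ l₄ : Fin 4,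
    delta4 f₁ l₁ f₂ l₂ f₃ l₃ f₄ l₄ ≤ 6 ∧ (delta4 f₁ l₁ f₂ l₂ f₃ l₃ f₄ l₄ = 6 →
      ¬(l₁ = 2 ∧ f₂ = 2) ∧ ¬(l₂ = 2 ∧ f₃ = 2) ∧ ¬(l₃ = 2 ∧ f₄ = 2) ∧ ¬(l₄ = 2 ∧ f₁ = 2)) := by
  fin_cases l₁ <;> fin_cases f₂ <;> decide

/-- **Lemma 4.5 (ii)/(iii), four blocks** (finite verification). [cite: Heuer2020, Lemma 4.5] -/
theorem delta4_le (f₁ l₁ f₂ l₂ f₃ l₃ f₄ l₄ : Fin 4) :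
    delta4 f₁ l₁ f₂ l₂ f₃ l₃ f₄ l₄ ≤ 6 ∧ (delta4 f₁ l₁ f₂ l₂ f₃ l₃ f₄ l₄ = 6 →
      ¬(l₁ = 2 ∧ f₂ = 2) ∧ ¬(l₂ = 2 ∧ f₃ = 2) ∧ ¬(l₃ = 2 ∧ f₄ = 2) ∧ ¬(l₄ = 2 ∧ f₁ = 2)) :=
  delta4_le_aux l₁ f₂ f₁ l₂ f₃ l₃ f₄ l₄

/-! ### `ν` of cyclic words and of lists -/

/-- `ν` of a cyclic word: the total weight of its cyclically adjacent pairs. [cite: Heuer2020, §4.1] -/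
def nuC {N : ℕ} (U : Fin N → Fin 4) : ℤ := ∑ y : Fin N, wt (U y) (U (finRotate N y))

/-- `ν` is invariant under rotation. [folklore] -/
theorem nuC_comp_pow {N : ℕ} (U : Fin N → Fin 4) (k : ℕ) : nuC (U ∘ ⇑(finRotate N ^ k)) = nuC U := by
  unfold nuC
  rw [← Equiv.sum_comp (finRotate N ^ k) (fun y => wt (U y) (U (finRotate N y)))]
  refine Finset.sum_congr rfl fun y _ => ?_
  simp only [Function.comp_apply]
  congr 2
  rw [← Perm.mul_apply, ← Perm.mul_apply, ← pow_succ, ← pow_succ']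

/-- `ν` of a list read cyclically. [cite: Heuer2020, §4.1] -/
def nuL (u : List (Fin 4)) : ℤ := nuC fun i : Fin u.length => u[i.val]

/-- Value of `finRotate` as a residue. [folklore] -/
theorem val_finRotate_eq_mod {N : ℕ} (y : Fin N) : (finRotate N y).val = (y.val + 1) % N := by
  have := Bardakov.val_finRotate_pow 1 y
  rwa [pow_one] at this

/-- Reindexing `ν` along an equality of lengths. [folklore] -/
theorem nuC_comp_cast {M N : ℕ} (h : M = N) (U : Fin N → Fin 4) : nuC (fun i : Fin M => U (i.cast h)) = nuC U := by
  subst h; rfl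

/-- `ν` of `List.ofFn`. [folklore] -/
theorem nuL_ofFn {N : ℕ} (U : Fin N → Fin 4) : nuL (List.ofFn U) = nuC U := by
  unfold nuL
  simp only [List.getElem_ofFn]
  exact nuC_comp_cast List.length_ofFn U

/-- `ν` of a list is invariant under rotation. [folklore] -/
theorem nuL_rotate (u : List (Fin 4)) (k : ℕ) : nuL (u.rotate k) = nuL u := by
  obtain ⟨U, hU⟩ := exists_eq_ofFn (u := u) rfl
  rw [hU, ← ofFn_comp_finRotate_pow', nuL_ofFn, nuL_ofFn, nuC_comp_pow]

/-- `ν` is invariant under `~r`. [folklore] -/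
theorem nuL_eq_of_isRotated {u u' : List (Fin 4)} (h : List.IsRotated u u') : nuL u = nuL u' := by
  obtain ⟨k, rfl⟩ := h
  exact (nuL_rotate u k).symm

/-- The linear part of `ν`: weights of adjacent pairs of a list (no wrap-around). [folklore] -/
def lin : List (Fin 4) → ℤ
  | [] => 0
  | [_] => 0
  | x :: y :: u => wt x y + lin (y :: u)

/-- `lin` of a cons onto a nonempty list. [folklore] -/
theorem lin_cons_cons (x y : Fin 4) (u : List (Fin 4)) : lin (x :: y :: u) = wt x y + lin (y :: u) := rfl

/-- `lin` of a concatenation of nonempty lists: add the junction. [folklore] -/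
theorem lin_append {u u' : List (Fin 4)} (hu : u ≠ []) (hu' : u' ≠ []) :
    lin (u ++ u') = lin u + lin u' + wt (u.getLast hu) (u'.head hu') := by
  induction u with
  | nil => exact absurd rfl hu
  | cons x u ih =>
    rcases u with _ | ⟨y, u⟩
    · rcases u' with _ | ⟨z, u'⟩
      · exact absurd rfl hu'
      · simp [lin, add_comm]
    · rw [List.cons_append, List.cons_append, lin_cons_cons, ← List.cons_append, ih (List.cons_ne_nil _ _), lin_cons_cons,
        List.getLast_cons (List.cons_ne_nil _ _)]
      ring

/-- `lin` as a sum over positions. [folklore] -/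
theorem lin_eq_sum (u : List (Fin 4)) :
    lin u = ∑ j : Fin (u.length - 1), wt (u[j.val]'(by omega)) (u[j.val + 1]'(by omega)) := by
  induction u with
  | nil => rfl
  | cons x u ih =>
    rcases u with _ | ⟨y, u⟩
    · rfl
    · have ih' : lin (y :: u) = ∑ j : Fin u.length, wt ((y :: u)[j.val]'(by simp))
          ((y :: u)[j.val + 1]'(by simp)) := ih
      show wt x y + lin (y :: u) = ∑ j : Fin (u.length + 1), wt ((x :: y :: u)[j.val]'(by simp))
        ((x :: y :: u)[j.val + 1]'(by simp; omega))
      rw [Fin.sum_univ_succ, ih']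
      simp

/-- **`ν = lin + ` the wrap-around pair.** [folklore] -/
theorem nuL_eq_lin (u : List (Fin 4)) (hu : u ≠ []) : nuL u = lin u + wt (u.getLast hu) (u.head hu) := by
  obtain ⟨m, hm⟩ : ∃ m, u.length = m + 1 := Nat.exists_eq_add_one_of_ne_zero (by simpa using List.ne_nil_iff_length_pos.1 hu |>.ne')
  unfold nuL nuC
  rw [lin_eq_sum, ← Fin.sum_congr' _ hm.symm]
  rw [Fin.sum_univ_castSucc]
  congr 1
  · rw [← Fin.sum_congr' _ (show u.length - 1 = m by omega).symm]
    refine Finset.sum_congr rfl fun j _ => ?_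
    simp only [Fin.val_cast, Fin.val_castSucc]
    congr 1
    have e : ((finRotate u.length) (Fin.cast hm.symm j.castSucc)).val = j.val + 1 := by
      rw [val_finRotate_eq_mod, Fin.val_cast, Fin.val_castSucc, Nat.mod_eq_of_lt (by omega)]
    simp only [e]
  · simp only [Fin.val_cast, Fin.val_last]
    rw [List.getLast_eq_getElem, List.head_eq_getElem]
    have e : ((finRotate u.length) (Fin.cast hm.symm (Fin.last m))).val = 0 := by
      rw [val_finRotate_eq_mod, Fin.val_cast, Fin.val_last, ← hm, Nat.mod_self]
    simp only [e, hm, Nat.add_one_sub_one]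

/-! ### Blocks summarised by their first and last letters -/

/-- The summary of a block: `none` if empty, else `(first, last)`. [folklore] -/
def bsum (w : List (Fin 4)) : Option (Fin 4 × Fin 4) :=
  match w with
  | [] => none
  | x :: u => some (x, (x :: u).getLast (List.cons_ne_nil _ _))

/-- Linear junction weights of a sequence of nonempty-block summaries. [folklore] -/
def linJ : List (Fin 4 × Fin 4) → ℤ
  | [] => 0
  | [_] => 0
  | p :: q :: ps => wt p.2 q.1 + linJ (q :: ps)

/-- The wrap-around junction weight. [folklore] -/
def wrapJ : List (Fin 4 × Fin 4) → ℤ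
  | [] => 0
  | p :: ps => wt ((p :: ps).getLast (List.cons_ne_nil _ _)).2 p.1

/-- **Cyclic junction sum** of a sequence of block summaries (empty blocks skipped). [folklore] -/
def js (os : List (Option (Fin 4 × Fin 4))) : ℤ := linJ os.reduceOption + wrapJ os.reduceOption

/-- The drop of `ν` under `w₁w₂w₃w₄ → w₁w₄w₃w₂` in terms of block summaries. [cite: Heuer2020, Lemma 4.5] -/
def deltaO (o₁ o₂ o₃ o₄ : Option (Fin 4 × Fin 4)) : ℤ := js [o₁, o₂, o₃, o₄] - js [o₁, o₄, o₃, o₂]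

/-- First letter at or after block `i` (cyclically), for four block summaries listed from block `i` on. [folklore] -/
def firstFrom (l : List (Option (Fin 4 × Fin 4))) : Option (Fin 4) := (l.reduceOption.head?).map Prod.fst

/-- Last letter strictly before block `i` (cyclically), for four block summaries listed from block `i` on. [folklore] -/
def lastBefore (l : List (Option (Fin 4 × Fin 4))) : Option (Fin 4) := (l.reduceOption.getLast?).map Prod.snd

/-- "The junction in front of block `i` is `cc`", for the block summaries rotated to start at block `i`. [folklore] -/
def jcc (l : List (Option (Fin 4 × Fin 4))) : Bool := decide (lastBefore l = some 2 ∧ firstFrom l = some 2)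

/-- **Lemma 4.5 (ii)/(iii), finite core with possibly empty blocks**: the drop is at most `6`,
and a drop of `6` has no `cc` junction in front of any of the four blocks (reduction to the
letter checks `delta4_le`/`delta3_le`; with two or more empty blocks the interchange is a rotation
and the drop is `0`). [cite: Heuer2020, Lemma 4.5] -/
theorem deltaO_le (o₁ o₂ o₃ o₄ : Option (Fin 4 × Fin 4)) :
    deltaO o₁ o₂ o₃ o₄ ≤ 6 ∧ (deltaO o₁ o₂ o₃ o₄ = 6 →
      jcc [o₁, o₂, o₃, o₄] = false ∧ jcc [o₂, o₃, o₄, o₁] = false ∧ jcc [o₃, o₄, o₁, o₂] = false ∧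
        jcc [o₄, o₁, o₂, o₃] = false) := by
  -- with at most two nonempty blocks the interchange is a rotation: the drop is `0`
  have triv : ∀ {P : Prop} (x : ℤ), x = 0 → (x ≤ 6 ∧ (x = 6 → P)) := by
    rintro P x rfl; exact ⟨by norm_num, fun h => absurd h (by norm_num)⟩
  rcases o₁ with _ | ⟨f₁, l₁⟩ <;> rcases o₂ with _ | ⟨f₂, l₂⟩ <;> rcases o₃ with _ | ⟨f₃, l₃⟩ <;> rcases o₄ with _ | ⟨f₄, l₄⟩
  · exact triv _ (by simp [deltaO, js, linJ, wrapJ, List.reduceOption])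
  · exact triv _ (by simp [deltaO, js, linJ, wrapJ, List.reduceOption])
  · exact triv _ (by simp [deltaO, js, linJ, wrapJ, List.reduceOption])
  · exact triv _ (by simp [deltaO, js, linJ, wrapJ, List.reduceOption]; ring)
  · exact triv _ (by simp [deltaO, js, linJ, wrapJ, List.reduceOption])
  · exact triv _ (by simp [deltaO, js, linJ, wrapJ, List.reduceOption]; ring)
  · exact triv _ (by simp [deltaO, js, linJ, wrapJ, List.reduceOption]; ring)
  · -- blocks 2, 3, 4
    have h := delta3_le f₂ l₂ f₃ l₃ f₄ l₄
    have e : deltaO none (some (f₂, l₂)) (some (f₃, l₃)) (some (f₄, l₄)) = delta3 f₂ l₂ f₃ l₃ f₄ l₄ := by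
      simp [deltaO, js, linJ, wrapJ, List.reduceOption, delta3]; ring
    rw [e]
    refine ⟨h.1, fun h6 => ?_⟩
    obtain ⟨h1, h2, h3⟩ := h.2 h6
    simp [jcc, firstFrom, lastBefore, List.reduceOption, h1, h2, h3]
  · exact triv _ (by simp [deltaO, js, linJ, wrapJ, List.reduceOption])
  · exact triv _ (by simp [deltaO, js, linJ, wrapJ, List.reduceOption])
  · exact triv _ (by simp [deltaO, js, linJ, wrapJ, List.reduceOption])
  · -- blocks 1, 3, 4
    have h := delta3_le f₁ l₁ f₃ l₃ f₄ l₄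
    have e : deltaO (some (f₁, l₁)) none (some (f₃, l₃)) (some (f₄, l₄)) = delta3 f₁ l₁ f₃ l₃ f₄ l₄ := by
      simp [deltaO, js, linJ, wrapJ, List.reduceOption, delta3]
    rw [e]
    refine ⟨h.1, fun h6 => ?_⟩
    obtain ⟨h1, h2, h3⟩ := h.2 h6
    simp [jcc, firstFrom, lastBefore, List.reduceOption, h1, h2, h3]
  · exact triv _ (by simp [deltaO, js, linJ, wrapJ, List.reduceOption])
  · -- blocks 1, 2, 4
    have h := delta3_le f₁ l₁ f₂ l₂ f₄ l₄
    have e : deltaO (some (f₁, l₁)) (some (f₂, l₂)) none (some (f₄, l₄)) = delta3 f₁ l₁ f₂ l₂ f₄ l₄ := by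
      simp [deltaO, js, linJ, wrapJ, List.reduceOption, delta3]
    rw [e]
    refine ⟨h.1, fun h6 => ?_⟩
    obtain ⟨h1, h2, h3⟩ := h.2 h6
    simp [jcc, firstFrom, lastBefore, List.reduceOption, h1, h2, h3]
  · -- blocks 1, 2, 3
    have h := delta3_le f₁ l₁ f₂ l₂ f₃ l₃
    have e : deltaO (some (f₁, l₁)) (some (f₂, l₂)) (some (f₃, l₃)) none = delta3 f₁ l₁ f₂ l₂ f₃ l₃ := by
      simp [deltaO, js, linJ, wrapJ, List.reduceOption, delta3]
    rw [e]
    refine ⟨h.1, fun h6 => ?_⟩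
    obtain ⟨h1, h2, h3⟩ := h.2 h6
    simp [jcc, firstFrom, lastBefore, List.reduceOption, h1, h2, h3]
  · -- all four blocks
    have h := delta4_le f₁ l₁ f₂ l₂ f₃ l₃ f₄ l₄
    have e : deltaO (some (f₁, l₁)) (some (f₂, l₂)) (some (f₃, l₃)) (some (f₄, l₄)) = delta4 f₁ l₁ f₂ l₂ f₃ l₃ f₄ l₄ := by
      simp [deltaO, js, linJ, wrapJ, List.reduceOption, delta4]; ring
    rw [e]
    refine ⟨h.1, fun h6 => ?_⟩
    obtain ⟨h1, h2, h3, h4⟩ := h.2 h6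
    simp [jcc, firstFrom, lastBefore, List.reduceOption, h1, h2, h3, h4]

/-! ### `ν` of a concatenation of blocks -/

/-- The summary of a nonempty block. [folklore] -/
theorem bsum_of_ne_nil {w : List (Fin 4)} (hw : w ≠ []) : bsum w = some (w.head hw, w.getLast hw) := by
  rcases w with _ | ⟨x, u⟩
  · exact absurd rfl hw
  · rfl

/-- The summary of the empty block. [folklore] -/
@[simp] theorem bsum_nil : bsum ([] : List (Fin 4)) = none := rfl

/-- The summary with defaults (agrees with `bsum` on nonempty blocks). [folklore] -/
def bsumD (w : List (Fin 4)) : Fin 4 × Fin 4 := (w.headD 0, w.getLastD 0)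

/-- `bsum = some ∘ bsumD` on nonempty blocks. [folklore] -/
theorem bsum_eq_bsumD {w : List (Fin 4)} (hw : w ≠ []) : bsum w = some (bsumD w) := by
  rcases w with _ | ⟨x, u⟩
  · exact absurd rfl hw
  · simp only [bsum, bsumD, List.headD_cons, Option.some.injEq, Prod.mk.injEq, true_and]
    rw [List.getLastD_eq_getLast?, List.getLast?_eq_some_getLast]
    rfl

/-- Components of `bsumD`. [folklore] -/
theorem bsumD_fst {w : List (Fin 4)} (hw : w ≠ []) : (bsumD w).1 = w.head hw := by
  rcases w with _ | ⟨x, u⟩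
  · exact absurd rfl hw
  · rfl

/-- Components of `bsumD`. [folklore] -/
theorem bsumD_snd {w : List (Fin 4)} (hw : w ≠ []) : (bsumD w).2 = w.getLast hw := by
  simp only [bsumD]
  rw [List.getLastD_eq_getLast?, List.getLast?_eq_some_getLast hw]
  rfl

/-- Summaries of a block list with the empty blocks removed. [folklore] -/
theorem reduceOption_map_bsum (ws : List (List (Fin 4))) :
    (ws.map bsum).reduceOption = (ws.filter fun w => !w.isEmpty).map bsumD := by
  induction ws with
  | nil => rfl
  | cons w ws ih =>
    rcases w with _ | ⟨x, u⟩
    · simpa using ih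
    · rw [List.map_cons, bsum_eq_bsumD (List.cons_ne_nil _ _), List.reduceOption_cons_of_some, ih,
        List.filter_cons_of_pos (by rfl), List.map_cons]

/-- Flattening ignores empty blocks. [folklore] -/
theorem flatten_filter_not_isEmpty (ws : List (List (Fin 4))) : (ws.filter fun w => !w.isEmpty).flatten = ws.flatten := by
  induction ws with
  | nil => rfl
  | cons w ws ih =>
    rcases w with _ | ⟨x, u⟩
    · simpa using ih
    · rw [List.filter_cons_of_pos (by rfl), List.flatten_cons, List.flatten_cons, ih]

/-- `lin` vanishes on blocks of length `≤ 1`; in particular `Σ lin` ignores empty blocks. [folklore] -/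
theorem sum_map_lin_filter (ws : List (List (Fin 4))) :
    ((ws.filter fun w => !w.isEmpty).map lin).sum = (ws.map lin).sum := by
  induction ws with
  | nil => rfl
  | cons w ws ih =>
    rcases w with _ | ⟨x, u⟩
    · simpa [lin] using ih
    · rw [List.filter_cons_of_pos (by rfl), List.map_cons, List.map_cons, List.sum_cons, List.sum_cons, ih]

/-- `lin` of a flattening of NONEMPTY blocks: the blocks' `lin` plus the linear junctions. [folklore] -/
theorem lin_flatten (ns : List (List (Fin 4))) (h : ∀ w ∈ ns, w ≠ []) :
    lin ns.flatten = (ns.map lin).sum + linJ (ns.map bsumD) := by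
  induction ns with
  | nil => rfl
  | cons w ns ih =>
    have hw : w ≠ [] := h w (by simp)
    rcases ns with _ | ⟨w', ns⟩
    · simp [linJ]
    · have hw' : w' ≠ [] := h w' (by simp)
      have hfl : (w' :: ns).flatten ≠ [] := by
        rw [List.flatten_cons]; exact List.append_ne_nil_of_left_ne_nil hw' _
      have ih' := ih (fun x hx => h x (List.mem_cons_of_mem _ hx))
      simp only [List.map_cons, List.sum_cons, linJ] at ih' ⊢
      rw [List.flatten_cons, lin_append hw hfl, ih', bsumD_snd hw, bsumD_fst hw']
      have e2 : w'.head hw' = (w' :: ns).flatten.head hfl := by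
        simp only [List.flatten_cons]
        rw [List.head_append_of_ne_nil]
      rw [e2]
      ring

section Flatten

/-- The wrap-around junction of a nonempty block list. [folklore] -/
theorem wrapJ_map_bsumD (ns : List (List (Fin 4))) (hns : ns ≠ []) :
    wrapJ (ns.map bsumD) = wt (bsumD (ns.getLast hns)).2 (bsumD (ns.head hns)).1 := by
  obtain ⟨w₀, ns', rfl⟩ := List.exists_cons_of_ne_nil hns
  show wt ((bsumD w₀ :: ns'.map bsumD).getLast (List.cons_ne_nil _ _)).2 (bsumD w₀).1 = _
  congr 2
  exact List.getLast_map (f := bsumD) (l := w₀ :: ns') (List.cons_ne_nil _ _)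

/-- **`ν` of a concatenation of blocks**: the blocks' `lin` plus the cyclic junction sum of their
summaries. [folklore] -/
theorem nuL_flatten (ws : List (List (Fin 4))) (h : ws.flatten ≠ []) :
    nuL ws.flatten = (ws.map lin).sum + js (ws.map bsum) := by
  set ns := ws.filter fun w => !w.isEmpty with hns
  have hne : ∀ w ∈ ns, w ≠ [] := by
    intro w hw
    rw [hns, List.mem_filter] at hw
    rcases w with _ | ⟨x, u⟩
    · simp at hw
    · exact List.cons_ne_nil _ _
  have hfl : ns.flatten = ws.flatten := flatten_filter_not_isEmpty ws
  rw [js, reduceOption_map_bsum, ← hns, ← sum_map_lin_filter ws, ← hns, ← hfl]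
  rw [← hfl] at h
  -- now all blocks are nonempty
  have hns0 : ns ≠ [] := by rintro h0; rw [h0] at h; exact h rfl
  rw [nuL_eq_lin _ h, lin_flatten ns hne, add_assoc]
  congr 1
  congr 1
  -- the wrap-around pair: last letter of the last block, first letter of the first block
  have hH : ns.head hns0 ≠ [] := hne _ (List.head_mem hns0)
  have hL : ns.getLast hns0 ≠ [] := hne _ (List.getLast_mem hns0)
  rw [wrapJ_map_bsumD ns hns0, bsumD_snd hL, bsumD_fst hH, List.getLast_getLast_eq_getLast_flatten hns0 hL,
    List.head_head_eq_head_flatten hns0 hH]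

end Flatten

/-! ### Lemma 4.5 (ii): an interchange lowers `ν` by at most `6` -/

/-- **`ν` under an interchange**: the drop is `deltaO` of the block summaries. [cite: Heuer2020, Lemma 4.5] -/
theorem nuL_interchange (w₁ w₂ w₃ w₄ : List (Fin 4)) (hne : w₁ ++ w₂ ++ w₃ ++ w₄ ≠ []) :
    nuL (w₁ ++ w₂ ++ w₃ ++ w₄) - nuL (w₁ ++ w₄ ++ w₃ ++ w₂) = deltaO (bsum w₁) (bsum w₂) (bsum w₃) (bsum w₄) := by
  have hne' : w₁ ++ w₄ ++ w₃ ++ w₂ ≠ [] := by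
    simp only [ne_eq, List.append_eq_nil_iff, not_and] at hne ⊢
    grind
  have e1 : w₁ ++ w₂ ++ w₃ ++ w₄ = [w₁, w₂, w₃, w₄].flatten := by simp
  have e2 : w₁ ++ w₄ ++ w₃ ++ w₂ = [w₁, w₄, w₃, w₂].flatten := by simp
  rw [e1] at hne ⊢
  rw [e2] at hne' ⊢
  rw [nuL_flatten _ hne, nuL_flatten _ hne', deltaO]
  simp only [List.map_cons, List.map_nil, List.sum_cons, List.sum_nil]
  ring

/-- **Lemma 4.5 (ii)**: a cyclic block interchange lowers `ν` by at most `6`. [cite: Heuer2020, Lemma 4.5 (ii)] -/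
theorem nuL_sub_le_of_isCBI {u u' : List (Fin 4)} (h : IsCBI u u') : nuL u - nuL u' ≤ 6 := by
  obtain ⟨v', w', hv, hw, w₁, w₂, w₃, w₄, rfl, rfl⟩ := h
  rw [← nuL_eq_of_isRotated hv, ← nuL_eq_of_isRotated hw]
  rcases eq_or_ne (w₁ ++ w₂ ++ w₃ ++ w₄) [] with h0 | h0
  · have : w₁ ++ w₄ ++ w₃ ++ w₂ = [] := by
      simp only [List.append_eq_nil_iff] at h0 ⊢
      exact ⟨⟨⟨h0.1.1.1, h0.2⟩, h0.1.2⟩, h0.1.1.2⟩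
    rw [h0, this]; decide
  · rw [nuL_interchange _ _ _ _ h0]
    exact (deltaO_le _ _ _ _).1

/-- Along `t` interchanges `ν` drops by at most `6t`. [cite: Heuer2020, proof of Thm. 4.1] -/
theorem Reach.nuL_sub_le : ∀ {t : ℕ} {u w : List (Fin 4)}, Reach t u w → nuL u - nuL w ≤ 6 * t
  | 0, _, _, h => by rw [nuL_eq_of_isRotated (reach_zero.1 h)]; simp
  | t + 1, _, _, ⟨_, h₁, h₂⟩ => by
    have := nuL_sub_le_of_isCBI h₁
    have := Reach.nuL_sub_le h₂
    push_cast
    linarith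

/-! ### Lemma 4.5 (iii): a drop of `6` cuts no `cc` -/

/-- The first letter of a flattening, from the block summaries. [folklore] -/
theorem head?_flatten_eq_firstFrom (ws : List (List (Fin 4))) : ws.flatten.head? = firstFrom (ws.map bsum) := by
  induction ws with
  | nil => rfl
  | cons w ws ih =>
    rcases w with _ | ⟨x, u⟩
    · simpa [firstFrom, List.reduceOption] using ih
    · simp [firstFrom, List.reduceOption, bsum]

/-- The last letter of a flattening, from the block summaries. [folklore] -/
theorem getLast?_flatten_eq_lastBefore (ws : List (List (Fin 4))) : ws.flatten.getLast? = lastBefore (ws.map bsum) := by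
  rw [lastBefore, reduceOption_map_bsum]
  rcases eq_or_ne ws.flatten [] with h0 | h0
  · have : (ws.filter fun w => !w.isEmpty) = [] := by
      rw [List.filter_eq_nil_iff]
      intro w hw
      have : w = [] := by
        rw [List.flatten_eq_nil_iff] at h0
        exact h0 w hw
      simp [this]
    rw [h0, this]; rfl
  · set ns := ws.filter fun w => !w.isEmpty with hns
    have hne : ∀ w ∈ ns, w ≠ [] := by
      intro w hw
      rw [hns, List.mem_filter] at hw
      rcases w with _ | ⟨x, u⟩
      · simp at hw
      · exact List.cons_ne_nil _ _
    have hfl : ns.flatten = ws.flatten := flatten_filter_not_isEmpty ws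
    rw [← hfl] at h0 ⊢
    have hns0 : ns ≠ [] := by rintro e; rw [e] at h0; exact h0 rfl
    have hL : ns.getLast hns0 ≠ [] := hne _ (List.getLast_mem hns0)
    rw [List.getLast?_eq_some_getLast h0, List.getLast?_eq_some_getLast (by simpa using hns0), Option.map_some,
      List.getLast_map, bsumD_snd hL, List.getLast_getLast_eq_getLast_flatten hns0 hL]

/-- Letters of a nonempty list at a residue and at the residue before it are the head and the
last letter of the corresponding rotation. [folklore] -/
theorem getElem_mod_eq_head_rotate (W : List (Fin 4)) (hW : W ≠ []) (p : ℕ) :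
    W[p % W.length]'(Nat.mod_lt _ (List.length_pos_iff.2 hW)) = (W.rotate p).head (by simpa using hW) := by
  rw [List.head_eq_getElem, List.getElem_rotate]
  simp

/-- Companion of `getElem_mod_eq_head_rotate` for the last letter. [folklore] -/
theorem getElem_mod_eq_getLast_rotate (W : List (Fin 4)) (hW : W ≠ []) (p : ℕ) :
    W[(p + W.length - 1) % W.length]'(Nat.mod_lt _ (List.length_pos_iff.2 hW)) =
      (W.rotate p).getLast (by simpa using hW) := by
  rw [List.getLast_eq_getElem, List.getElem_rotate]
  have hN := List.length_pos_iff.2 hW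
  congr 1
  simp only [List.length_rotate]
  congr 1
  omega

/-- A `cc` at a residue pair of `W` read through a rotation into blocks. [folklore] -/
theorem cc_iff_jcc (W : List (Fin 4)) (hW : W ≠ []) (p : ℕ) (ws : List (List (Fin 4))) (hrot : W.rotate p = ws.flatten) :
    (W[(p + W.length - 1) % W.length]'(Nat.mod_lt _ (List.length_pos_iff.2 hW)) = 2 ∧
      W[p % W.length]'(Nat.mod_lt _ (List.length_pos_iff.2 hW)) = 2) ↔ jcc (ws.map bsum) = true := by
  have hR : W.rotate p ≠ [] := by simpa using hW
  rw [getElem_mod_eq_head_rotate W hW p, getElem_mod_eq_getLast_rotate W hW p, jcc, decide_eq_true_eq,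
    ← head?_flatten_eq_firstFrom, ← getLast?_flatten_eq_lastBefore, ← hrot, List.head?_eq_some_head hR,
    List.getLast?_eq_some_getLast hR, Option.some.injEq, Option.some.injEq]

/-- **Lemma 4.5 (iii)**: if the interchange `w₁w₂w₃w₄ → w₁w₄w₃w₂` lowers `ν` by `6`, then none of
the four junctions in front of the blocks (cyclically) is a `cc`. [cite: Heuer2020, Lemma 4.5 (iii)] -/
theorem not_cc_of_drop_six (w₁ w₂ w₃ w₄ : List (Fin 4)) (hne : w₁ ++ w₂ ++ w₃ ++ w₄ ≠ [])
    (h6 : nuL (w₁ ++ w₂ ++ w₃ ++ w₄) - nuL (w₁ ++ w₄ ++ w₃ ++ w₂) = 6) {p : ℕ}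
    (hp : p = 0 ∨ p = w₁.length ∨ p = w₁.length + w₂.length ∨ p = w₁.length + w₂.length + w₃.length) :
    ¬ ((w₁ ++ w₂ ++ w₃ ++ w₄)[(p + (w₁ ++ w₂ ++ w₃ ++ w₄).length - 1) % (w₁ ++ w₂ ++ w₃ ++ w₄).length]'(Nat.mod_lt _
        (List.length_pos_iff.2 hne)) = 2 ∧
      (w₁ ++ w₂ ++ w₃ ++ w₄)[p % (w₁ ++ w₂ ++ w₃ ++ w₄).length]'(Nat.mod_lt _ (List.length_pos_iff.2 hne)) = 2) := by
  rw [nuL_interchange _ _ _ _ hne] at h6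
  obtain ⟨j1, j2, j3, j4⟩ := (deltaO_le _ _ _ _).2 h6
  set W := w₁ ++ w₂ ++ w₃ ++ w₄ with hWdef
  rcases hp with rfl | rfl | rfl | rfl
  · rw [cc_iff_jcc W hne 0 [w₁, w₂, w₃, w₄] (by simp [hWdef])]
    simpa using j1
  · rw [cc_iff_jcc W hne _ [w₂, w₃, w₄, w₁] (by
      rw [hWdef, List.append_assoc, List.append_assoc, List.rotate_append_length_eq]; simp)]
    simpa using j2
  · rw [cc_iff_jcc W hne _ [w₃, w₄, w₁, w₂] (by
      rw [hWdef, ← List.length_append, List.append_assoc, List.rotate_append_length_eq]; simp)]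
    simpa using j3
  · rw [cc_iff_jcc W hne _ [w₄, w₁, w₂, w₃] (by
      rw [hWdef, ← List.length_append, ← List.length_append, List.rotate_append_length_eq]; simp)]
    simpa using j4


/-! ### The step map of an optimal interchange cuts no `cc` -/

/-- Residue arithmetic: the position before `σ z`. [folklore] -/
theorem val_eq_mod_of_finRotate {N : ℕ} (z : Fin N) : z.val = ((finRotate N z).val + N - 1) % N := by
  have hz := z.isLt
  rw [Bardakov.val_finRotate]
  split_ifs with h
  · rw [Nat.zero_add, Nat.mod_eq_of_lt (by omega)]; omega
  · rw [show z.val + 1 + N - 1 = z.val + N by omega, Nat.add_mod_right, Nat.mod_eq_of_lt hz]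

/-- **The step map of an interchange lowering `ν` by `6` cuts no `cc`**: a position permutation
`ψ` with at most four cut points transporting the letters, such that — when the drop of `ν` is `6` —
no cut point sits on a `cc` (Lemma 4.5 (iii) read through the block map). [cite: Heuer2020, Lemma 4.5 (iii)] -/
theorem exists_stepMap_nocc {N : ℕ} {U U' : Fin N → Fin 4} (h : IsCBI (List.ofFn U) (List.ofFn U')) :
    ∃ (ψ : Perm (Fin N)) (C : Finset (Fin N)), IsStepMap ψ C ∧ (∀ x, U' (ψ x) = U x) ∧
      (nuC U - nuC U' = 6 → ∀ y ∈ C, ¬(U y = 2 ∧ U (finRotate N y) = 2)) := by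
  obtain ⟨v₀, w₀, hv₀, hw₀, hbi⟩ := h
  obtain ⟨V₀, k₁, rfl, hV⟩ := exists_comp_pow_of_isRotated hv₀
  obtain ⟨W₀, k₂, rfl, hW⟩ := exists_comp_pow_of_isRotated hw₀
  obtain ⟨w₁, w₂, w₃, w₄, hv, hu⟩ := hbi
  have hn : N = w₁.length + w₂.length + w₃.length + w₄.length := by
    have := congrArg List.length hv
    simp only [List.length_ofFn, List.length_append] at this
    omega
  set γ₀ := blockPerm w₁.length w₂.length w₃.length w₄.length N hn with hγ₀
  -- letters: `W₀ (γ₀ y) = V₀ y`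
  have hWV : ∀ y, W₀ (γ₀ y) = V₀ y := by
    intro y
    have hV' : V₀ y = (List.ofFn V₀)[y.val]'(by rw [List.length_ofFn]; exact y.isLt) := by rw [List.getElem_ofFn]
    have hW' : W₀ (γ₀ y) = (List.ofFn W₀)[(γ₀ y).val]'(by rw [List.length_ofFn]; exact (γ₀ y).isLt) := by
      rw [List.getElem_ofFn]
    rw [hV', hW', List.getElem_of_eq hu, List.getElem_of_eq hv]
    exact getElem_interchange_blockFun w₁ w₂ w₃ w₄ rfl rfl rfl rfl y.val (by simp only [List.length_append]; omega)
      (by have := @blockFun_lt w₁.length w₂.length w₃.length w₄.length y.val (by omega)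
          simp only [List.length_append]; omega)
  have h1 : IsStepMap (γ₀ * finRotate N ^ k₁) _ :=
    (isStepMap_blockPerm hn).mul (isStepMap_pow k₁)
      (by rw [Finset.card_empty, Nat.zero_add]; exact (isStepMap_blockPerm (N := N) hn).1)
  have h2 : IsStepMap ((finRotate N ^ k₂)⁻¹ * (γ₀ * finRotate N ^ k₁)) _ :=
    (isStepMap_pow_inv k₂).mul h1 (by rw [Finset.card_empty, Nat.add_zero]; exact h1.1)
  refine ⟨_, _, h2, fun x => ?_, fun h6 y hy => ?_⟩
  · rw [Perm.mul_apply, Perm.mul_apply, hW, Function.comp_apply, Perm.inv_def, Equiv.apply_symm_apply, hWV, hV,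
      Function.comp_apply]
  · -- `y` is a cut point: `z = σ^{k₁} y` sits right before a block start of `w₁w₂w₃w₄`
    simp only [Finset.empty_union, Finset.map_empty, Finset.union_empty, Finset.mem_map, Finset.mem_filter,
      Finset.mem_univ, true_and] at hy
    obtain ⟨z, hz, hzy⟩ := hy
    have hzy' : (finRotate N ^ k₁) y = z := by rw [← hzy]; simp
    have hp : (finRotate N z).val = 0 ∨ (finRotate N z).val = w₁.length ∨ (finRotate N z).val = w₁.length + w₂.length ∨
        (finRotate N z).val = w₁.length + w₂.length + w₃.length := by
      by_contra hcon
      push Not at hcon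
      exact hz (blockPerm_finRotate hn z hcon.1 hcon.2.1 hcon.2.2.1 hcon.2.2.2)
    -- the drop of `ν` is that of the interchange of `w₁w₂w₃w₄`
    have h6' : nuL (w₁ ++ w₂ ++ w₃ ++ w₄) - nuL (w₁ ++ w₄ ++ w₃ ++ w₂) = 6 := by
      rw [← hv, ← hu, nuL_ofFn, nuL_ofFn, ← nuC_comp_pow V₀ k₁, ← nuC_comp_pow W₀ k₂, ← hV, ← hW]
      exact h6
    -- the letters at `y`, `σ y` are those of `W = w₁w₂w₃w₄` at `z`, `σ z`
    set W := w₁ ++ w₂ ++ w₃ ++ w₄ with hWdef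
    have hWlen : W.length = N := by rw [← hv, List.length_ofFn]
    have hne : W ≠ [] := by
      rw [← List.length_pos_iff, hWlen]; exact Fin.pos y
    have hUy : U y = W[z.val]'(by rw [hWlen]; exact z.isLt) := by
      rw [hV, Function.comp_apply, hzy', List.getElem_of_eq hv.symm, List.getElem_ofFn]
    have hUy' : U (finRotate N y) = W[(finRotate N z).val]'(by rw [hWlen]; exact (finRotate N z).isLt) := by
      rw [hV, Function.comp_apply, pow_finRotate_comm k₁ y, hzy', List.getElem_of_eq hv.symm, List.getElem_ofFn]
    have key := not_cc_of_drop_six w₁ w₂ w₃ w₄ hne h6' hp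
    rw [hUy, hUy']
    intro hcc
    apply key
    refine ⟨?_, ?_⟩
    · rw [← hcc.1]
      congr 1
      rw [hWlen]
      exact (val_eq_mod_of_finRotate z).symm
    · rw [← hcc.2]
      congr 1
      rw [hWlen]
      exact Nat.mod_eq_of_lt (finRotate N z).isLt

/-- **Tracking runs of `c` through an optimal sequence**: along `t` interchanges lowering `ν` by
`6t` in total (so by `6` each), intervals on which the word reads `c⋯c` are never cut and move
rigidly. [cite: Heuer2020, proof of Thm. 4.1 (Claim 4.4)] -/
theorem exists_track_runs {N : ℕ} {ι : Type*} (start : ι → Fin N) (len : ι → ℕ) (A : Finset ι) :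
    ∀ (t : ℕ) (U₀ : Fin N → Fin 4) (w : List (Fin 4)), Reach t (List.ofFn U₀) w →
      nuL (List.ofFn U₀) - nuL w = 6 * t →
      (∀ κ ∈ A, ∀ o, o < len κ → U₀ ((finRotate N ^ o) (start κ)) = 2) →
      ∃ (Φ : Perm (Fin N)) (U : Fin N → Fin 4), List.IsRotated (List.ofFn U) w ∧ (∀ x, U (Φ x) = U₀ x) ∧
        ∀ κ ∈ A, ∀ o, o < len κ → Φ ((finRotate N ^ o) (start κ)) = (finRotate N ^ o) (Φ (start κ)) := by
  intro t
  induction t generalizing start with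
  | zero =>
    intro U₀ w h _ _
    exact ⟨1, U₀, reach_zero.1 h, fun x => rfl, fun κ _ o _ => rfl⟩
  | succ t ih =>
    intro U₀ w h hν hc
    obtain ⟨u₁, hcbi, hrest⟩ := h
    obtain ⟨U₁, rfl⟩ : ∃ U₁ : Fin N → Fin 4, u₁ = List.ofFn U₁ :=
      ⟨fun i => u₁[i.val]'(by rw [← hcbi.perm.length_eq, List.length_ofFn]; exact i.isLt),
        List.ext_getElem (by rw [List.length_ofFn, ← hcbi.perm.length_eq, List.length_ofFn]) fun i h₁ h₂ => by simp⟩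
    obtain ⟨ψ, C, hstep, hU₁, hnocc⟩ := exists_stepMap_nocc hcbi
    -- the drop of `ν` is `6` at this step and `6t` afterwards
    have hd1 := nuL_sub_le_of_isCBI hcbi
    have hd2 := Reach.nuL_sub_le hrest
    have h6 : nuC U₀ - nuC U₁ = 6 := by rw [← nuL_ofFn, ← nuL_ofFn]; push_cast at hν hd2; linarith
    have hν' : nuL (List.ofFn U₁) - nuL w = 6 * t := by push_cast at hν hd2 ⊢; linarith
    have hnocc' := hnocc h6
    -- no run is cut: its interior adjacencies are `cc`
    have hrig : ∀ κ ∈ A, ∀ o, o < len κ → ψ ((finRotate N ^ o) (start κ)) = (finRotate N ^ o) (ψ (start κ)) := by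
      intro κ hκ o ho
      refine stepMap_pow_apply hstep (start κ) (L := len κ) (fun o' ho' hmem => ?_) o ho
      refine hnocc' _ hmem ⟨hc κ hκ o' (by omega), ?_⟩
      rw [← Perm.mul_apply, ← pow_succ']
      exact hc κ hκ (o' + 1) ho'
    have hc' : ∀ κ ∈ A, ∀ o, o < len κ → U₁ ((finRotate N ^ o) ((⇑ψ ∘ start) κ)) = 2 := by
      intro κ hκ o ho
      rw [Function.comp_apply, ← hrig κ hκ o ho, hU₁]
      exact hc κ hκ o ho
    obtain ⟨Φ', U, hrot, hU, hrig'⟩ := ih (⇑ψ ∘ start) U₁ w hrest hν' hc'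
    refine ⟨Φ' * ψ, U, hrot, fun x => by rw [Perm.mul_apply, hU, hU₁], fun κ hκ o ho => ?_⟩
    rw [Perm.mul_apply, Perm.mul_apply, hrig κ hκ o ho]
    exact hrig' κ hκ o ho

end CBI

end Literature.GroupTheory.CombinatorialGroupTheory
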